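import Summits.Ventures.HodgeRepro2.T5CyclotomicSevenInertThree
import Summits.Ventures.HodgeRepro2.T5RecordSatakeInertToyDegree
import Summits.Ventures.HodgeRepro2.T5RecordSatakeDegreeCells
import Summits.Ventures.HodgeRepro2.T5RecordSatakeToy

/-!
# The record's spherical Hecke algebra on the FIELD OF RECORD `ℚ(ζ₇)` at the inert place `(3)`: `q = 27` in numerals

Tier-5 support N3 / §G-N4.2 (seat p3, gen 78). File 253 exhibits the place `(3)` of `ℚ(ζ₇)⁺` that stays prime in
the sextic Galois CM field of record `ℚ(ζ₇)`, with `N(v) = 27`. This file reads the Satake chain of the record's own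
pair (files 233 / 236 / 245 / 248 / 251) at that place, with the Gram matrix `H₀ = diag(1, 1, −1)` of file 237:

* **`heckeAlgebra_mul_comm_record_seven_three`**, **`nonempty_algEquiv_polynomial_record_seven_three`** —
  `H(U(1 ⊗ H₀), K_{(3)})` is commutative and `≃ k[X]` for every family `l` of generators and every field `k`;
* **`exists_doubleCosetOp_aeval_bijective_and_ncard_record_seven_three`** — the generator `T₁ = 1_{K_v g₀ K_v}` has
  `deg T₁ = 27⁴ + 27 = 531468`;
* **`exists_cells_ncard_and_three_term_record_seven_three`** — cells `gₙ` with `deg Tₙ = 19684 · 27^{4n−3}`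
  (`n ≥ 1`), `deg T₀ = 1`, `T₁ T_{n+2} = T_{n+3} + 26 T_{n+2} + 531441 T_{n+1}` and
  `T₁² = T₂ + 26 T₁ + 531468 T₀` (`k` of characteristic `0`);
* `exists_cells_ncard_one_two_record_seven_three` — `deg T₀ = 1`, `deg T₁ = 531468`, `deg T₂ = 282443885388`;
* `exists_generators_and_…` — with the generators `l` of `𝓞_{ℚ(ζ₇)}` over `𝓞_{ℚ(ζ₇)⁺}` supplied by file 235.

§8(d): uses an L-value-free non-vanishing device: NO.
-/

open Matrix NumberField NumberField.IsCMField IsDedekindDomain IsDedekindDomain.HeightOneSpectrum Module Polynomial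
  MulAction
open scoped TensorProduct Pointwise
open Summit.Ventures.HodgeRepro2.T5UnitaryGroupForm Summit.Ventures.HodgeRepro2.T5UnitaryHeckeAdjoint
  Summit.Ventures.HodgeRepro2.T5HeckePermutationModule Summit.Ventures.HodgeRepro2.T5HeckeDoubleCoset
  Summit.Ventures.HodgeRepro2.T5RecordHyperspecial Summit.Ventures.HodgeRepro2.T5GlobalLatticeAlmostAll
  Summit.Ventures.HodgeRepro2.T5FinitePlaceSplitClassification Summit.Ventures.HodgeRepro2.T5RecordSatakeIntrinsic
  Summit.Ventures.HodgeRepro2.T5CMFieldSquareDatum Summit.Ventures.HodgeRepro2.T5RecordSatakeToy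
  Summit.Ventures.HodgeRepro2.T5RecordSatakeDegreeIntrinsic
  Summit.Ventures.HodgeRepro2.T5RecordSatakeRecurrenceIntrinsic
  Summit.Ventures.HodgeRepro2.T5SplitPlaceUnitaryGroup Summit.Ventures.HodgeRepro2.T5NonSplitPlaceUnitaryGroup
  Summit.Ventures.HodgeRepro2.T5FinitePlaceCM Summit.Ventures.HodgeRepro2.T5StarOfInvolution
  Summit.Ventures.HodgeRepro2.T5RecordSatake Summit.Ventures.HodgeRepro2.T5RecordSatakeInert
  Summit.Ventures.HodgeRepro2.T5RecordSatakeCell Summit.Ventures.HodgeRepro2.T5RecordSatakeDegree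
  Summit.Ventures.HodgeRepro2.T5RecordSatakeRecurrence Summit.Ventures.HodgeRepro2.T5RecordSatakeInertToyDegree
  Summit.Ventures.HodgeRepro2.T5RecordSatakeDegreeCells Summit.Ventures.HodgeRepro2.T5CyclotomicSevenInertThree

namespace Summit.Ventures.HodgeRepro2.T5RecordSatakeSevenToy

section Record

variable (K : Type*) [Field K] [CharZero K] [IsCyclotomicExtension {7} ℚ K]

/-- **THE RECORD'S SPHERICAL HECKE ALGEBRA ON `ℚ(ζ₇)` AT THE INERT PLACE `(3)` IS COMMUTATIVE** (file 236's
`heckeAlgebra_mul_comm_record_of_staysPrime` with `hmap := map_vThreeSeven`, `H := H₀`). -/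
theorem heckeAlgebra_mul_comm_record_seven_three (k : Type*) [Field k] {r : ℕ} (l : Fin r → 𝓞 K)
    (hl : Submodule.span (𝓞 (maximalRealSubfield K)) (Set.range l) = ⊤)
    (T S : (haveI := numberField' K; haveI := isCMField' K; letI := tensorStarRing K (vThreeSeven K);
      ↥(heckeAlgebra k (recordHyperspecial K (vThreeSeven K) l (gramToy K))))) :
    T * S = S * T :=
  haveI := numberField' K
  haveI := isCMField' K
  heckeAlgebra_mul_comm_record_of_staysPrime K (vThreeSeven K) (wThreeSeven K) l k hl (map_vThreeSeven K)
    gramToy_isHermitian isUnit_det_gramToy (notMem_badSet_gramToy _) T S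

/-- **THE RECORD'S SPHERICAL HECKE ALGEBRA ON `ℚ(ζ₇)` AT `(3)` IS `k[X]`** — the Satake chain (rows 1–14 of
T5-SATAKE-KERNEL-p3.md) read on the record's own pair at an inert place of the FIELD OF RECORD (file 236's
`nonempty_algEquiv_polynomial_record_of_staysPrime`). -/
theorem nonempty_algEquiv_polynomial_record_seven_three (k : Type*) [Field k] {r : ℕ} (l : Fin r → 𝓞 K)
    (hl : Submodule.span (𝓞 (maximalRealSubfield K)) (Set.range l) = ⊤) :
    haveI := numberField' K; haveI := isCMField' K
    Nonempty (Polynomial k ≃ₐ[k]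
      (letI := tensorStarRing K (vThreeSeven K);
        ↥(heckeAlgebra k (recordHyperspecial K (vThreeSeven K) l (gramToy K))))) :=
  haveI := numberField' K
  haveI := isCMField' K
  nonempty_algEquiv_polynomial_record_of_staysPrime K (vThreeSeven K) (wThreeSeven K) l k hl (map_vThreeSeven K)
    gramToy_isHermitian isUnit_det_gramToy (notMem_badSet_gramToy _)

/-- **`deg T₁ = 531468` AT THE INERT PLACE `(3)` OF `ℚ(ζ₇)`** (file 245's datum-free generator with
`(N(v)³ + 1) · N(v) = 19684 · 27 = 531468 = 27⁴ + 27`): for every family `l` of generators of `𝓞_{ℚ(ζ₇)}` over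
`𝓞_{ℚ(ζ₇)⁺}` and
every field `k`, some `g₀ ∈ U(1 ⊗ H₀)` has a double coset `K_{(3)} g₀ K_{(3)}` of exactly `531468` left cosets whose
characteristic function `T₁` generates `H(U(1 ⊗ H₀), K_{(3)})` (`aeval T₁ : k[X] → H` bijective). -/
theorem exists_doubleCosetOp_aeval_bijective_and_ncard_record_seven_three (k : Type*) [Field k] {r : ℕ}
    (l : Fin r → 𝓞 K) (hl : Submodule.span (𝓞 (maximalRealSubfield K)) (Set.range l) = ⊤) :
    haveI := numberField' K; haveI := isCMField' K
    ∃ g₀ : (letI := tensorStarRing K (vThreeSeven K);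
        ↥(formUnitaryGroup (tensorGram K (vThreeSeven K) (gramToy K)))),
      (orbit (recordHyperspecial K (vThreeSeven K) l (gramToy K))
        (g₀ : _ ⧸ recordHyperspecial K (vThreeSeven K) l (gramToy K))).ncard = 531468 ∧
      ∃ _ : Finite (orbit (recordHyperspecial K (vThreeSeven K) l (gramToy K))
          (g₀ : _ ⧸ recordHyperspecial K (vThreeSeven K) l (gramToy K))),
        Function.Bijective (aeval (doubleCosetOp k (recordHyperspecial K (vThreeSeven K) l (gramToy K)) g₀) :
          k[X] →ₐ[k] heckeAlgebra k (recordHyperspecial K (vThreeSeven K) l (gramToy K))) := by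
  haveI := numberField' K
  haveI := isCMField' K
  have key := @exists_doubleCosetOp_aeval_bijective_and_ncard_record_of_staysPrime K _ (numberField' K)
    (isCMField' K) (vThreeSeven K) (wThreeSeven K) _ (map_vThreeSeven K) _ l k _ hl _ gramToy_isHermitian
    isUnit_det_gramToy (notMem_badSet_gramToy _)
  obtain ⟨g₀, hn, hb⟩ := key
  exact ⟨g₀, hn.trans (by rw [absNorm_vThreeSeven K]; norm_num), hb⟩

/-- **THE DEGREES OF ALL THE CELLS AND THE TREE RECURSION AT THE INERT PLACE `(3)` OF `ℚ(ζ₇)`, AS NUMERALS**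
(file 251's datum-free theorem with `N(v) = 27`: `(N(v)³ + 1) N(v)^{4n−3} = 19684 · 27^{4n−3}`, `N(v) − 1 = 26`,
`N(v)⁴ = 531441`, `N(v)⁴ + N(v) = 531468`): for every family `l` of generators of `𝓞_{ℚ(ζ₇)}` over `𝓞_{ℚ(ζ₇)⁺}` and
every
field `k` of characteristic `0`, cells `gₙ ∈ U(1 ⊗ H₀)` with `#(K_{(3)} gₙ K_{(3)} / K_{(3)}) = 19684 · 27^{4n−3}`
(`n ≥ 1`), `#(K_{(3)} g₀ K_{(3)} / K_{(3)}) = 1`, and `Tₙ := 1_{K_{(3)} gₙ K_{(3)}}` satisfying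
`T₁ T_{n+2} = T_{n+3} + 26 T_{n+2} + 531441 T_{n+1}` and `T₁² = T₂ + 26 T₁ + 531468 T₀`. -/
theorem exists_cells_ncard_and_three_term_record_seven_three (k : Type*) [Field k] [CharZero k] {r : ℕ}
    (l : Fin r → 𝓞 K) (hl : Submodule.span (𝓞 (maximalRealSubfield K)) (Set.range l) = ⊤) :
    haveI := numberField' K; haveI := isCMField' K
    ∃ g : ℕ → (letI := tensorStarRing K (vThreeSeven K);
        ↥(formUnitaryGroup (tensorGram K (vThreeSeven K) (gramToy K)))),
      (∀ n, 1 ≤ n → (orbit (recordHyperspecial K (vThreeSeven K) l (gramToy K))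
        (g n : _ ⧸ recordHyperspecial K (vThreeSeven K) l (gramToy K))).ncard = 19684 * 27 ^ (4 * n - 3)) ∧
      (orbit (recordHyperspecial K (vThreeSeven K) l (gramToy K))
        (g 0 : _ ⧸ recordHyperspecial K (vThreeSeven K) l (gramToy K))).ncard = 1 ∧
      ∃ hfin : ∀ n, Finite (orbit (recordHyperspecial K (vThreeSeven K) l (gramToy K))
          (g n : _ ⧸ recordHyperspecial K (vThreeSeven K) l (gramToy K))),
        (∀ n, letI := hfin 1; letI := hfin (n + 1 + 1); letI := hfin (n + 1 + 1 + 1); letI := hfin (n + 1);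
          doubleCosetOp k (recordHyperspecial K (vThreeSeven K) l (gramToy K)) (g 1) *
              doubleCosetOp k (recordHyperspecial K (vThreeSeven K) l (gramToy K)) (g (n + 1 + 1)) =
            doubleCosetOp k (recordHyperspecial K (vThreeSeven K) l (gramToy K)) (g (n + 1 + 1 + 1)) +
              (26 : k) • doubleCosetOp k (recordHyperspecial K (vThreeSeven K) l (gramToy K)) (g (n + 1 + 1)) +
              (531441 : k) • doubleCosetOp k (recordHyperspecial K (vThreeSeven K) l (gramToy K)) (g (n + 1))) ∧
        (letI := hfin 1; letI := hfin (0 + 1); letI := hfin (0 + 1 + 1); letI := hfin 0;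
          doubleCosetOp k (recordHyperspecial K (vThreeSeven K) l (gramToy K)) (g 1) *
              doubleCosetOp k (recordHyperspecial K (vThreeSeven K) l (gramToy K)) (g (0 + 1)) =
            doubleCosetOp k (recordHyperspecial K (vThreeSeven K) l (gramToy K)) (g (0 + 1 + 1)) +
              (26 : k) • doubleCosetOp k (recordHyperspecial K (vThreeSeven K) l (gramToy K)) (g (0 + 1)) +
              (531468 : k) • doubleCosetOp k (recordHyperspecial K (vThreeSeven K) l (gramToy K)) (g 0)) := by
  haveI := numberField' K
  haveI := isCMField' K
  have e1 : ((Ideal.absNorm (vThreeSeven K).asIdeal : k) - 1) = 26 := by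
    rw [absNorm_vThreeSeven K]; norm_num
  have e2 : (Ideal.absNorm (vThreeSeven K).asIdeal : k) ^ 4 = 531441 := by
    rw [absNorm_vThreeSeven K]; norm_num
  have e3 : (Ideal.absNorm (vThreeSeven K).asIdeal : k) ^ 4 + Ideal.absNorm (vThreeSeven K).asIdeal = 531468 := by
    rw [absNorm_vThreeSeven K]; norm_num
  have key := @exists_cells_three_term_and_ncard_record_of_staysPrime' K _ (numberField' K) (isCMField' K)
    (vThreeSeven K) (wThreeSeven K) _ (map_vThreeSeven K) _ l k _ _ hl _ gramToy_isHermitian isUnit_det_gramToy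
    (notMem_badSet_gramToy _)
  obtain ⟨g, hdeg, hdeg0, hfin, h1, h2⟩ := key
  exact ⟨g, fun n hn => (hdeg n hn).trans (by rw [absNorm_vThreeSeven K]; norm_num), hdeg0, hfin,
    fun n => three_term_congr e1 e2 (h1 n), three_term_congr e1 e3 h2⟩

/-- **THE FIRST THREE DEGREES AS NUMERALS ON THE FIELD OF RECORD**: cells `g₀, g₁, g₂ ∈ U(1 ⊗ H₀)` at `(3)` with
`deg T₀ = 1`, `deg T₁ = 531468` and `deg T₂ = 282443885388 = 19684 · 27⁵`, whose characteristic functions satisfy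
`T₁² = T₂ + 26 T₁ + 531468 T₀`. -/
theorem exists_cells_ncard_one_two_record_seven_three (k : Type*) [Field k] [CharZero k] {r : ℕ}
    (l : Fin r → 𝓞 K) (hl : Submodule.span (𝓞 (maximalRealSubfield K)) (Set.range l) = ⊤) :
    haveI := numberField' K; haveI := isCMField' K
    ∃ g : ℕ → (letI := tensorStarRing K (vThreeSeven K);
        ↥(formUnitaryGroup (tensorGram K (vThreeSeven K) (gramToy K)))),
      (orbit (recordHyperspecial K (vThreeSeven K) l (gramToy K))
        (g 0 : _ ⧸ recordHyperspecial K (vThreeSeven K) l (gramToy K))).ncard = 1 ∧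
      (orbit (recordHyperspecial K (vThreeSeven K) l (gramToy K))
        (g 1 : _ ⧸ recordHyperspecial K (vThreeSeven K) l (gramToy K))).ncard = 531468 ∧
      (orbit (recordHyperspecial K (vThreeSeven K) l (gramToy K))
        (g 2 : _ ⧸ recordHyperspecial K (vThreeSeven K) l (gramToy K))).ncard = 282443885388 ∧
      ∃ hfin : ∀ n, Finite (orbit (recordHyperspecial K (vThreeSeven K) l (gramToy K))
          (g n : _ ⧸ recordHyperspecial K (vThreeSeven K) l (gramToy K))),
        (letI := hfin 1; letI := hfin (0 + 1); letI := hfin (0 + 1 + 1); letI := hfin 0;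
          doubleCosetOp k (recordHyperspecial K (vThreeSeven K) l (gramToy K)) (g 1) *
              doubleCosetOp k (recordHyperspecial K (vThreeSeven K) l (gramToy K)) (g (0 + 1)) =
            doubleCosetOp k (recordHyperspecial K (vThreeSeven K) l (gramToy K)) (g (0 + 1 + 1)) +
              (26 : k) • doubleCosetOp k (recordHyperspecial K (vThreeSeven K) l (gramToy K)) (g (0 + 1)) +
              (531468 : k) • doubleCosetOp k (recordHyperspecial K (vThreeSeven K) l (gramToy K)) (g 0)) :=
  haveI := numberField' K
  haveI := isCMField' K
  (exists_cells_ncard_and_three_term_record_seven_three K k l hl).elim fun g h => h.elim fun hdeg h =>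
    h.elim fun hdeg0 h => h.elim fun hfin h => h.elim fun _ h2 =>
      ⟨g, hdeg0, (hdeg 1 le_rfl).trans (by norm_num), (hdeg 2 (by norm_num)).trans (by norm_num), hfin, h2⟩

/-- The cells, their degrees and their recursion at `(3)` on `ℚ(ζ₇)` with the generators `l` supplied (file 235's
`exists_fin_span_eq_top`). -/
theorem exists_generators_and_cells_ncard_and_three_term_record_seven_three (k : Type*) [Field k] [CharZero k] :
    haveI := numberField' K; haveI := isCMField' K
    ∃ (r : ℕ) (l : Fin r → 𝓞 K), Submodule.span (𝓞 (maximalRealSubfield K)) (Set.range l) = ⊤ ∧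
      ∃ g : ℕ → (letI := tensorStarRing K (vThreeSeven K);
          ↥(formUnitaryGroup (tensorGram K (vThreeSeven K) (gramToy K)))),
        (∀ n, 1 ≤ n → (orbit (recordHyperspecial K (vThreeSeven K) l (gramToy K))
          (g n : _ ⧸ recordHyperspecial K (vThreeSeven K) l (gramToy K))).ncard = 19684 * 27 ^ (4 * n - 3)) ∧
        (orbit (recordHyperspecial K (vThreeSeven K) l (gramToy K))
          (g 0 : _ ⧸ recordHyperspecial K (vThreeSeven K) l (gramToy K))).ncard = 1 ∧
        ∃ hfin : ∀ n, Finite (orbit (recordHyperspecial K (vThreeSeven K) l (gramToy K))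
            (g n : _ ⧸ recordHyperspecial K (vThreeSeven K) l (gramToy K))),
          (∀ n, letI := hfin 1; letI := hfin (n + 1 + 1); letI := hfin (n + 1 + 1 + 1); letI := hfin (n + 1);
            doubleCosetOp k (recordHyperspecial K (vThreeSeven K) l (gramToy K)) (g 1) *
                doubleCosetOp k (recordHyperspecial K (vThreeSeven K) l (gramToy K)) (g (n + 1 + 1)) =
              doubleCosetOp k (recordHyperspecial K (vThreeSeven K) l (gramToy K)) (g (n + 1 + 1 + 1)) +
                (26 : k) • doubleCosetOp k (recordHyperspecial K (vThreeSeven K) l (gramToy K)) (g (n + 1 + 1)) +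
                (531441 : k) • doubleCosetOp k (recordHyperspecial K (vThreeSeven K) l (gramToy K)) (g (n + 1))) ∧
          (letI := hfin 1; letI := hfin (0 + 1); letI := hfin (0 + 1 + 1); letI := hfin 0;
            doubleCosetOp k (recordHyperspecial K (vThreeSeven K) l (gramToy K)) (g 1) *
                doubleCosetOp k (recordHyperspecial K (vThreeSeven K) l (gramToy K)) (g (0 + 1)) =
              doubleCosetOp k (recordHyperspecial K (vThreeSeven K) l (gramToy K)) (g (0 + 1 + 1)) +
                (26 : k) • doubleCosetOp k (recordHyperspecial K (vThreeSeven K) l (gramToy K)) (g (0 + 1)) +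
                (531468 : k) • doubleCosetOp k (recordHyperspecial K (vThreeSeven K) l (gramToy K)) (g 0)) :=
  haveI := numberField' K
  haveI := isCMField' K
  (exists_fin_span_eq_top K).elim fun r h => h.elim fun l hl =>
    ⟨r, l, hl, exists_cells_ncard_and_three_term_record_seven_three K k l hl⟩

end Record

end Summit.Ventures.HodgeRepro2.T5RecordSatakeSevenToy
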